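import Mathlib
import HarnessLib
import Literature.Analysis.FluidPDE.ClassicalSolution
import Literature.Analysis.FluidPDE.ClassicalHigherSmoothing
import Literature.Analysis.Calculus.MixedPartialDerivWithin

/-!
# Route `QuarterLogPincer`, crux `TypeIQuantSubcubicExp` (stmt-NavierStokesRegularity-24077), line `ember_census` —
# E1a `hotWitness_far`: the CLOCK-FAR half of E1 `HotWitness` is a theorem

ns-idea-7's line `Cruxes/TypeIQuantSubcubicExp/Lines/ember_census.lean` (v1.1) carries the stub E1
`HotWitness` (:329): in the crux frame with virtual Type-I rate `M`, a candidate annulus of level `k+1` that is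
NOT quiet on the final window `[t₁ − s/32, t₁]` has an ε-hot event nearby.  Its docstring proves the
contrapositive in two cases; this file is case (i), the **clock-far case** `T + τ − t₁ > r²`, `r = Γ√s`
(director-ns dss_141 (1): E1 := E1a ⊕ E1b; E1b, the clock-near case, is the Gustafson–Kang–Tsai `(∞,1)` port
and is NOT here).  In the far case there is nothing to find: every point of `[0, t₁]` has clock `> r`, so the
rate gives the GLOBAL speed bound `‖u‖ ≤ M/r` there, and the quantitative KNSS smoothing of bounded classical
solutions with square-integrable slices (`Literature.Analysis.FluidPDE.exists_norm_iteratedFDeriv_le_of_speed_le`,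
KNSS 2009 (4.10) for every order, this cell's `ClassicalHigherSmoothing.lean`) bounds
`‖∇ʲu(t, x)‖ ≤ C_j (M/r)^{j+1} = C_j M^{j+1} Γ^{-(j+1)} s^{-(j+1)/2}` for ALL `x` once `t > (r/M)²`, which the room
`9r² ≤ t₁` guarantees on the final window; for `Γ ≥ Γ₀(μ, M) := (C₀ + C₁ + C₂ + 1) M^{3+3μ}` this is
`≤ M^{-3μ} s^{-(j+1)/2}` (`j ≤ 2`) — the annulus (indeed all of space) IS quiet.  The endpoint `t = t₁ = T` of the
frame is reached by continuity of the spatial Taylor coefficients of a field smooth on `[0, T] × ℝ³`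
(`continuousWithinAt_iteratedFDeriv_slice`).  Following ns-afl-r1's typed note (2026-08-29T06:16Z) the
threshold is quantified UPWARD (`∃ Γ₀, ∀ Γ ≥ Γ₀`), so that E1a recombines with any E1b by `Γ := max`.

* `norm_iteratedFDeriv_le_of_typeI_far` — the smoothing estimate at the Type-I speed `M/r` up to `t₁`, for every
  order `k`, whenever the clock at `t₁` exceeds `r`;
* `hotWitness_far_scale` — E1a for an arbitrary scale `s > 0` (conclusion for all `x`);
* `hotWitness_far` — E1a with E1's binders (`a t₁ x₀ k R`, `s = levelScale a t₁ (k+1) = t₁e^{-2a(k+1)}` unfolded,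
  the two annulus guards carried and unused), conclusion = E1's quiet-annulus clause.

HONEST FRAME: statements about HYPOTHETICAL classical solutions obeying a Type-I rate; an implication used by a
line on an OPEN crux; nothing here bears on 24077's truth, the DSS wall W7 or Navier–Stokes regularity (OPEN /
not proved).  pub-ns-dss typer (g38), `--supports stmt-NavierStokesRegularity-24077`.
-/

noncomputable section

set_option linter.dupNamespace false

namespace Summit.NavierStokesRegularity.NavierStokesRegularity.Cruxes.TypeIQuantSubcubicExp.EmberCensus

open MeasureTheory Set Function Metric Filter Topology
open scoped ENNReal NNReal
open Literature.Analysis Literature.Analysis.FluidPDE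

/-! ### The endpoint: spatial Taylor coefficients of a space–time smooth field are continuous in time -/

/-- For a field jointly smooth on `S × ℝ³` (`S` a set of unique differentiability, e.g. `[0, T]`), the spatial
Taylor coefficient `τ ↦ Dⁿ(u τ)(x)` is continuous within `S` at every `t ∈ S` (the slice derivative is the joint
within-derivative composed with `(inr, …, inr)`, `iteratedFDerivWithin_slice_snd_prod`). -/
theorem continuousWithinAt_iteratedFDeriv_slice {S : Set ℝ} (hS : UniqueDiffOn ℝ S)
    {u : ℝ → (EuclideanSpace ℝ (Fin 3)) → (EuclideanSpace ℝ (Fin 3))} (hu : IsSmoothSpaceTimeOn S u) (n : ℕ)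
    (x : (EuclideanSpace ℝ (Fin 3))) {t : ℝ} (ht : t ∈ S) :
    ContinuousWithinAt (fun τ => iteratedFDeriv ℝ n (u τ) x) S t := by
  have hprod : UniqueDiffOn ℝ (S ×ˢ (univ : Set (EuclideanSpace ℝ (Fin 3)))) := hS.prod uniqueDiffOn_univ
  have h1 : ContinuousOn (iteratedFDerivWithin ℝ n (uncurry u) (S ×ˢ univ)) (S ×ˢ univ) :=
    hu.continuousOn_iteratedFDerivWithin (by exact_mod_cast le_top) hprod
  have h2 : ContinuousWithinAt (fun τ => iteratedFDerivWithin ℝ n (uncurry u) (S ×ˢ univ) (τ, x)) S t := by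
    have hmk : ContinuousWithinAt (fun τ : ℝ => ((τ, x) : ℝ × (EuclideanSpace ℝ (Fin 3)))) S t :=
      (continuous_id.prodMk continuous_const).continuousWithinAt
    exact ContinuousWithinAt.comp (f := fun τ : ℝ => ((τ, x) : ℝ × (EuclideanSpace ℝ (Fin 3)))) (x := t)
      (h1 (t, x) ⟨ht, mem_univ _⟩) hmk fun τ hτ => ⟨hτ, mem_univ _⟩
  have h3 : ContinuousWithinAt (fun τ => (iteratedFDerivWithin ℝ n (uncurry u) (S ×ˢ univ) (τ, x))
      |>.compContinuousLinearMap (fun _ => ContinuousLinearMap.inr ℝ ℝ (EuclideanSpace ℝ (Fin 3)))) S t :=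
    (ContinuousMultilinearMap.compContinuousLinearMapL
        (fun _ : Fin n => ContinuousLinearMap.inr ℝ ℝ (EuclideanSpace ℝ (Fin 3)))).continuous.continuousAt
      |>.comp_continuousWithinAt h2
  have key : ∀ τ ∈ S, iteratedFDeriv ℝ n (u τ) x = ((iteratedFDerivWithin ℝ n (uncurry u) (S ×ˢ univ) (τ, x))
      |>.compContinuousLinearMap (fun _ => ContinuousLinearMap.inr ℝ ℝ (EuclideanSpace ℝ (Fin 3)))) := by
    intro τ hτ
    have h := Literature.Analysis.Calculus.iteratedFDerivWithin_slice_snd_prod (Φ := uncurry u) (n := (⊤ : ℕ∞))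
      hu hS uniqueDiffOn_univ hτ (i := n) (by exact_mod_cast le_top) (mem_univ x)
    rw [iteratedFDerivWithin_univ] at h
    exact h
  exact h3.congr (fun τ hτ => key τ hτ) (key t ht)

/-! ### Smoothing at the Type-I speed, far from the virtual blow-up time -/

/-- **Derivative bounds at the Type-I speed `M/r`, up to `t₁`, when the clock at `t₁` exceeds `r`.**  For every
order `k` there is `C_k ≥ 0` such that: a classical solution on `[0, T] × ℝ³` (`ν = 1`, unforced) with
square-integrable slices and the Type-I rate `‖u(t, x)‖ ≤ M (T + τ − t)^{-1/2}` (`τ, M, r > 0`), at a horizon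
`t₁ ≤ T` with `r² < T + τ − t₁`, satisfies `‖Dᵏu(t)(x)‖ ≤ C_k (M/r)^{k+1}` for all `x` and all
`t ∈ ((r/M)², t₁]`: the rate is the speed bound `M/r` on `[0, T']` for every `T' < T + τ − r²`, and
`exists_norm_iteratedFDeriv_le_of_speed_le` applies below `T`; the endpoint `t = T` follows by
`continuousWithinAt_iteratedFDeriv_slice`. -/
theorem norm_iteratedFDeriv_le_of_typeI_far (k : ℕ) : ∃ C : ℝ, 0 ≤ C ∧
    ∀ {T τ M r t₁ : ℝ} {u : ℝ → (EuclideanSpace ℝ (Fin 3)) → (EuclideanSpace ℝ (Fin 3))}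
      {p : ℝ → (EuclideanSpace ℝ (Fin 3)) → ℝ}, IsClassicalNSSolutionOn (Icc 0 T) 1 0 u p →
      (∃ K : NNReal, ∀ t ∈ Icc 0 T, eLpNorm (u t) 2 volume ≤ K) → 0 < τ → 0 < M → 0 < r →
      (∀ t ∈ Icc 0 T, ∀ x : (EuclideanSpace ℝ (Fin 3)), ‖u t x‖ ≤ M * (T + τ - t) ^ (-(1 / 2 : ℝ))) →
      t₁ ≤ T → r ^ 2 < T + τ - t₁ →
      ∀ t ∈ Ioc (r ^ 2 / M ^ 2) t₁, ∀ x : (EuclideanSpace ℝ (Fin 3)),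
        ‖iteratedFDeriv ℝ k (u t) x‖ ≤ C * (M / r) ^ (k + 1) := by
  obtain ⟨C, hC0, hC⟩ := exists_norm_iteratedFDeriv_le_of_speed_le k
  refine ⟨C, hC0, ?_⟩
  intro T τ M r t₁ u p hcl hL2 hτ hM hr hrate ht₁T hclock t ht x
  obtain ⟨K, hK⟩ := hL2
  set G : ℝ := M / r with hG
  have hGpos : 0 < G := div_pos hM hr
  have hG2 : 1 / G ^ 2 = r ^ 2 / M ^ 2 := by rw [hG]; field_simp
  have hcl' : IsClassicalNSSolutionOn (Ico 0 T) 1 0 u p := hcl.mono Ico_subset_Icc_self (uniqueDiffOn_Ico 0 T)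
  -- the rate is the speed bound `M / r` wherever the clock exceeds `r`
  have hspeed : ∀ t' ∈ Icc 0 T, r ^ 2 < T + τ - t' → ∀ y : (EuclideanSpace ℝ (Fin 3)), ‖u t' y‖ ≤ G := by
    intro t' ht' hfar y
    have hpos : 0 < T + τ - t' := lt_trans (pow_pos hr 2) hfar
    have hsqrt : r ≤ Real.sqrt (T + τ - t') := by
      rw [← Real.sqrt_sq hr.le]
      exact Real.sqrt_le_sqrt hfar.le
    have hrpow : (T + τ - t') ^ (-(1 / 2 : ℝ)) = (Real.sqrt (T + τ - t'))⁻¹ := by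
      rw [Real.rpow_neg hpos.le, Real.sqrt_eq_rpow]
    calc ‖u t' y‖ ≤ M * (T + τ - t') ^ (-(1 / 2 : ℝ)) := hrate t' ht' y
      _ = M / Real.sqrt (T + τ - t') := by rw [hrpow, div_eq_mul_inv]
      _ ≤ M / r := div_le_div_of_nonneg_left hM.le hr hsqrt
  -- (A) below `T`
  have hA : ∀ t' : ℝ, r ^ 2 / M ^ 2 < t' → t' ≤ t₁ → t' < T → ∀ y : (EuclideanSpace ℝ (Fin 3)),
      ‖iteratedFDeriv ℝ k (u t') y‖ ≤ C * G ^ (k + 1) := by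
    intro t' ht'l ht'1 ht'T y
    have ht'pos : 0 < t' := lt_trans (by positivity) ht'l
    have hlt : t' < min T (T + τ - r ^ 2) := lt_min ht'T (by linarith)
    set T' : ℝ := (t' + min T (T + τ - r ^ 2)) / 2 with hT'
    have ht'T' : t' < T' := by rw [hT']; linarith
    have hT'lt : T' < min T (T + τ - r ^ 2) := by rw [hT']; linarith
    have hT'T : T' < T := hT'lt.trans_le (min_le_left _ _)
    have hT'far : T' < T + τ - r ^ 2 := hT'lt.trans_le (min_le_right _ _)
    have hT'pos : 0 < T' := ht'pos.trans ht'T'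
    have hbd : ∀ s ∈ Icc 0 T', ∀ y : (EuclideanSpace ℝ (Fin 3)), ‖u s y‖ ≤ G := fun s hs y =>
      hspeed s ⟨hs.1, hs.2.trans hT'T.le⟩ (by linarith [hs.2]) y
    have hL2' : ∀ s ∈ Icc 0 T', eLpNorm (u s) 2 volume ≤ (K : ℝ≥0∞) := fun s hs =>
      hK s ⟨hs.1, hs.2.trans hT'T.le⟩
    have hmem : t' ∈ Ioo (1 / G ^ 2) T' := ⟨by rw [hG2]; exact ht'l, ht'T'⟩
    have h := hC one_pos hGpos hcl' hT'pos hT'T hbd ENNReal.coe_ne_top hL2' t' hmem y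
    simpa only [one_pow, div_one] using h
  -- (B) the endpoint `t = T` by continuity within `[0, T]`
  rcases lt_or_eq_of_le (ht.2.trans ht₁T) with htT | htT
  · exact hA t ht.1 ht.2 htT x
  · have hlow : r ^ 2 / M ^ 2 < T := htT ▸ ht.1
    have hTt₁ : T ≤ t₁ := htT ▸ ht.2
    have hT0 : 0 ≤ T := le_trans (by positivity) hlow.le
    have hcont : ContinuousWithinAt (fun τ => iteratedFDeriv ℝ k (u τ) x) (Icc 0 T) T :=
      continuousWithinAt_iteratedFDeriv_slice (uniqueDiffOn_Icc (hlow.trans_le' (by positivity)))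
        hcl.smooth_velocity k x (right_mem_Icc.2 hT0)
    have hsub : Ioo (r ^ 2 / M ^ 2) T ⊆ Icc 0 T := fun τ hτ => ⟨le_trans (by positivity) hτ.1.le, hτ.2.le⟩
    have hcont' : Tendsto (fun τ => ‖iteratedFDeriv ℝ k (u τ) x‖) (𝓝[Ioo (r ^ 2 / M ^ 2) T] T)
        (𝓝 ‖iteratedFDeriv ℝ k (u T) x‖) := (hcont.mono hsub).norm
    haveI : (𝓝[Ioo (r ^ 2 / M ^ 2) T] T).NeBot := by
      refine mem_closure_iff_nhdsWithin_neBot.1 ?_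
      rw [closure_Ioo hlow.ne]
      exact right_mem_Icc.2 hlow.le
    rw [htT]
    refine le_of_tendsto hcont' (eventually_nhdsWithin_of_forall fun τ hτ => ?_)
    exact hA τ hτ.1 (hτ.2.le.trans hTt₁) hτ.2 x

/-! ### E1a -/

/-- **E1a — `HotWitness`, clock-far case, for an arbitrary scale `s > 0`.**  For `μ > 0`, `M ≥ 1` there is
`Γ₀ = Γ₀(μ, M) ≥ 1` such that for every `Γ ≥ Γ₀`, in the crux frame with virtual Type-I rate `M`: if
`t₁ ∈ (0, T]`, `9 (Γ√s)² ≤ t₁` (room) and the clock at `t₁` exceeds `r := Γ√s`, `(Γ√s)² < T + τ − t₁`, then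
on the final window `[t₁ − s/32, t₁]`, EVERYWHERE in space, `‖∇ʲu(t, x)‖ ≤ M^{-3μ} s^{-(j+1)/2}` for `j ≤ 2`.
(`Γ₀ := (C₀ + C₁ + C₂ + 1) M^{3+3μ}` with the constants of `norm_iteratedFDeriv_le_of_typeI_far`.) -/
theorem hotWitness_far_scale :
    ∀ μ M : ℝ, 0 < μ → 1 ≤ M → ∃ Γ₀ : ℝ, 1 ≤ Γ₀ ∧ ∀ Γ : ℝ, Γ₀ ≤ Γ →
    ∀ (T τ : ℝ) (u : ℝ → (EuclideanSpace ℝ (Fin 3)) → (EuclideanSpace ℝ (Fin 3)))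
      (p : ℝ → (EuclideanSpace ℝ (Fin 3)) → ℝ),
      (IsClassicalNSSolutionOn (Icc 0 T) 1 0 u p ∧
          ∀ m : ℕ, ∃ C : NNReal, ∀ t ∈ Icc 0 T, eLpNorm (iteratedFDeriv ℝ m (u t)) 2 volume ≤ C) →
        0 < τ →
        (∀ t ∈ Icc 0 T, ∀ x : (EuclideanSpace ℝ (Fin 3)), ‖u t x‖ ≤ M * (T + τ - t) ^ (-(1 / 2 : ℝ))) →
        ∀ (s t₁ : ℝ), 0 < s → t₁ ∈ Ioc 0 T →
          9 * (Γ * Real.sqrt s) ^ 2 ≤ t₁ →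
          (Γ * Real.sqrt s) ^ 2 < T + τ - t₁ →
          ∀ t ∈ Icc (t₁ - s / 32) t₁, ∀ x : (EuclideanSpace ℝ (Fin 3)), ∀ j : ℕ, j ≤ 2 →
            ‖iteratedFDeriv ℝ j (u t) x‖ ≤ M ^ (-(3 * μ)) * s ^ (-(((j : ℝ) + 1) / 2)) := by
  intro μ M hμ hM
  obtain ⟨C₀, hC₀0, hC₀⟩ := norm_iteratedFDeriv_le_of_typeI_far 0
  obtain ⟨C₁, hC₁0, hC₁⟩ := norm_iteratedFDeriv_le_of_typeI_far 1
  obtain ⟨C₂, hC₂0, hC₂⟩ := norm_iteratedFDeriv_le_of_typeI_far 2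
  set Cs : ℝ := C₀ + C₁ + C₂ with hCs
  have hCs0 : 0 ≤ Cs := by rw [hCs]; positivity
  have hM0 : 0 < M := by linarith
  have hMpow : 1 ≤ M ^ (3 + 3 * μ) := Real.one_le_rpow hM (by linarith)
  refine ⟨(Cs + 1) * M ^ (3 + 3 * μ), ?_, ?_⟩
  · nlinarith
  intro Γ hΓ T τ u p hframe hτ hrate s t₁ hs ht₁ hroom hclock t ht x j hj
  have hΓ1 : 1 ≤ Γ := by nlinarith
  have hΓ0 : 0 < Γ := by linarith
  have hsq : 0 < Real.sqrt s := Real.sqrt_pos.2 hs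
  set r : ℝ := Γ * Real.sqrt s with hr
  have hr0 : 0 < r := mul_pos hΓ0 hsq
  have hr2 : r ^ 2 = Γ ^ 2 * s := by rw [hr, mul_pow, Real.sq_sqrt hs.le]
  -- the `L²` clause of the frame
  have hL2 : ∃ K : NNReal, ∀ t ∈ Icc 0 T, eLpNorm (u t) 2 volume ≤ K := by
    obtain ⟨K, hK⟩ := hframe.2 0
    refine ⟨K, fun t' ht' => ?_⟩
    have e : eLpNorm (u t') 2 volume = eLpNorm (iteratedFDeriv ℝ 0 (u t')) 2 volume :=
      eLpNorm_congr_norm_ae (Eventually.of_forall fun x => (norm_iteratedFDeriv_zero (𝕜 := ℝ)).symm)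
    rw [e]; exact hK t' ht'
  -- the window lies above `(r/M)²`
  have hwin : r ^ 2 / M ^ 2 < t := by
    have h1 : r ^ 2 / M ^ 2 ≤ r ^ 2 := by
      rw [div_le_iff₀ (by positivity)]
      have : r ^ 2 * 1 ≤ r ^ 2 * M ^ 2 :=
        mul_le_mul_of_nonneg_left (by nlinarith) (sq_nonneg r)
      linarith
    have h2 : s ≤ r ^ 2 := by
      rw [hr2]
      have : 1 * s ≤ Γ ^ 2 * s := mul_le_mul_of_nonneg_right (by nlinarith) hs.le
      linarith
    have h3 : t₁ - s / 32 ≤ t := ht.1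
    nlinarith [sq_nonneg r]
  have htmem : t ∈ Ioc (r ^ 2 / M ^ 2) t₁ := ⟨hwin, ht.2⟩
  -- the smoothing estimate of order `j ≤ 2` with the common constant `Cs`
  have hD : ‖iteratedFDeriv ℝ j (u t) x‖ ≤ Cs * (M / r) ^ (j + 1) := by
    have hGp : 0 ≤ (M / r) ^ (j + 1) := pow_nonneg (div_nonneg hM0.le hr0.le) _
    interval_cases j
    · exact (hC₀ hframe.1 hL2 hτ hM0 hr0 hrate ht₁.2 hclock t htmem x).trans
        (mul_le_mul_of_nonneg_right (by rw [hCs]; linarith) hGp)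
    · exact (hC₁ hframe.1 hL2 hτ hM0 hr0 hrate ht₁.2 hclock t htmem x).trans
        (mul_le_mul_of_nonneg_right (by rw [hCs]; linarith) hGp)
    · exact (hC₂ hframe.1 hL2 hτ hM0 hr0 hrate ht₁.2 hclock t htmem x).trans
        (mul_le_mul_of_nonneg_right (by rw [hCs]; linarith) hGp)
  -- the threshold: `Cs M^{j+1} ≤ M^{-3μ} Γ^{j+1}` for `Γ ≥ (Cs + 1) M^{3+3μ}`
  have hthr : Cs * M ^ (j + 1) ≤ M ^ (-(3 * μ)) * Γ ^ (j + 1) := by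
    have hM3μ : 0 < M ^ (3 * μ) := Real.rpow_pos_of_pos hM0 _
    have hsplit : M ^ (3 + 3 * μ) = M ^ 3 * M ^ (3 * μ) := by
      rw [Real.rpow_add hM0]
      congr 1
      exact_mod_cast Real.rpow_natCast M 3
    have hMj : M ^ (j + 1) ≤ M ^ 3 := pow_le_pow_right₀ hM (by omega)
    have hΓj : Γ ≤ Γ ^ (j + 1) := le_self_pow₀ hΓ1 (by omega)
    have h1 : Cs * M ^ (j + 1) * M ^ (3 * μ) ≤ Γ ^ (j + 1) := by
      calc Cs * M ^ (j + 1) * M ^ (3 * μ) ≤ Cs * M ^ 3 * M ^ (3 * μ) := by gcongr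
        _ = Cs * M ^ (3 + 3 * μ) := by rw [hsplit]; ring
        _ ≤ (Cs + 1) * M ^ (3 + 3 * μ) := by nlinarith
        _ ≤ Γ := hΓ
        _ ≤ Γ ^ (j + 1) := hΓj
    rw [Real.rpow_neg hM0.le, ← div_eq_inv_mul, le_div_iff₀ hM3μ]
    exact h1
  -- the scale factor: `(√s)^{-(j+1)} = s^{-(j+1)/2}`
  have hscale : ((Real.sqrt s) ^ (j + 1))⁻¹ = s ^ (-(((j : ℝ) + 1) / 2)) := by
    rw [Real.rpow_neg hs.le, Real.sqrt_eq_rpow, ← Real.rpow_natCast, ← Real.rpow_mul hs.le]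
    congr 2
    push_cast
    ring
  have hsqj : 0 < (Real.sqrt s) ^ (j + 1) := pow_pos hsq _
  calc ‖iteratedFDeriv ℝ j (u t) x‖ ≤ Cs * (M / r) ^ (j + 1) := hD
    _ = Cs * M ^ (j + 1) / Γ ^ (j + 1) * ((Real.sqrt s) ^ (j + 1))⁻¹ := by
        rw [hr, div_pow, mul_pow]
        field_simp
    _ ≤ M ^ (-(3 * μ)) * Γ ^ (j + 1) / Γ ^ (j + 1) * ((Real.sqrt s) ^ (j + 1))⁻¹ := by
        gcongr
    _ = M ^ (-(3 * μ)) * s ^ (-(((j : ℝ) + 1) / 2)) := by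
        rw [mul_div_assoc, div_self (pow_ne_zero _ hΓ0.ne'), mul_one, hscale]

/-- **E1a — `HotWitness`, clock-far case, with E1's binders** (`Lines/ember_census.lean` :329; the level scale
`s = levelScale a t₁ (k+1) = t₁ · e^{-2a(k+1)}` is written out, the annulus guards `4M√s ≤ R`,
`M^{10μ}R ≤ eᵃ√s` are carried and not used): for `μ > 0`, `M ≥ 1` there is `Γ₀(μ, M) ≥ 1` such that for all
`Γ ≥ Γ₀`, in the crux frame with virtual rate `M`, a candidate annulus of level `k+1` with room `9(Γ√s)² ≤ t₁`
whose horizon is CLOCK-FAR, `(Γ√s)² < T + τ − t₁`, IS quiet on the final window: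
`‖∇ʲu‖ ≤ M^{-3μ} s^{-(j+1)/2}`, `j ≤ 2` (indeed at every point of space, `hotWitness_far_scale`). -/
theorem hotWitness_far :
    ∀ μ M : ℝ, 0 < μ → 1 ≤ M → ∃ Γ₀ : ℝ, 1 ≤ Γ₀ ∧ ∀ Γ : ℝ, Γ₀ ≤ Γ →
    ∀ (T τ : ℝ) (u : ℝ → (EuclideanSpace ℝ (Fin 3)) → (EuclideanSpace ℝ (Fin 3)))
      (p : ℝ → (EuclideanSpace ℝ (Fin 3)) → ℝ),
      (IsClassicalNSSolutionOn (Icc 0 T) 1 0 u p ∧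
          ∀ m : ℕ, ∃ C : NNReal, ∀ t ∈ Icc 0 T, eLpNorm (iteratedFDeriv ℝ m (u t)) 2 volume ≤ C) →
        0 < τ →
        (∀ t ∈ Icc 0 T, ∀ x : (EuclideanSpace ℝ (Fin 3)), ‖u t x‖ ≤ M * (T + τ - t) ^ (-(1 / 2 : ℝ))) →
        ∀ (a t₁ : ℝ) (x₀ : (EuclideanSpace ℝ (Fin 3))) (k : ℕ) (R : ℝ), t₁ ∈ Ioc 0 T →
          9 * (Γ * Real.sqrt (t₁ * Real.exp (-2 * a * ↑(k + 1)))) ^ 2 ≤ t₁ →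
          4 * M * Real.sqrt (t₁ * Real.exp (-2 * a * ↑(k + 1))) ≤ R →
          M ^ (10 * μ) * R ≤ Real.exp a * Real.sqrt (t₁ * Real.exp (-2 * a * ↑(k + 1))) →
          (Γ * Real.sqrt (t₁ * Real.exp (-2 * a * ↑(k + 1)))) ^ 2 < T + τ - t₁ →
          ∀ t ∈ Icc (t₁ - t₁ * Real.exp (-2 * a * ↑(k + 1)) / 32) t₁, ∀ x : (EuclideanSpace ℝ (Fin 3)),
            R < ‖x - x₀‖ → ‖x - x₀‖ < M ^ (10 * μ) * R → ∀ j : ℕ, j ≤ 2 →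
              ‖iteratedFDeriv ℝ j (u t) x‖ ≤
                M ^ (-(3 * μ)) * (t₁ * Real.exp (-2 * a * ↑(k + 1))) ^ (-(((j : ℝ) + 1) / 2)) := by
  intro μ M hμ hM
  obtain ⟨Γ₀, hΓ₀, h⟩ := hotWitness_far_scale μ M hμ hM
  refine ⟨Γ₀, hΓ₀, ?_⟩
  intro Γ hΓ T τ u p hframe hτ hrate a t₁ _x₀ k _R ht₁ hroom _ _ hclock t ht x _ _ j hj
  exact h Γ hΓ T τ u p hframe hτ hrate _ t₁ (mul_pos ht₁.1 (Real.exp_pos _)) ht₁ hroom hclock t ht x j hj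

end Summit.NavierStokesRegularity.NavierStokesRegularity.Cruxes.TypeIQuantSubcubicExp.EmberCensus

end
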